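import Literature.AlgebraicGeometry.HodgeTheory.WeilClasses
import Literature.AlgebraicGeometry.HodgeTheory.MotivatedClasses
import Literature.AlgebraicGeometry.Motives.HyperbolicWeilType

/-!
# Crux `HodgeAbelianVarieties` (stmt-HodgeConjecture-1333), line `e-step-secant-induction`: shared VOCABULARY of the
# registered stubs (definitions file, `--supports`; nothing here restates the crux or asserts anything)

Route `PadicSemiregularLift`, crux r4 `HodgeAbelianVarieties := ∀ A : AbelianVariety ℂ, HodgeConjectureFor A.dim A.X`.
The line's skeleton (`Cruxes/HodgeAbelianVarieties/Lines/e_step_secant_induction.lean`, lead gen 2, registered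
2026-08-16) states its four stubs over five class-level predicates on REAL carriers; the stub-workers' helper files
(`Theorems/PadicSemiregularLiftHodgeAbelianVarietiesStub*.lean`) must all speak the SAME predicates, so they are landed
once, here, byte-identical to the skeleton (same namespace `…Cruxes.HodgeAbelianVarieties.EStepSecantInduction`,
same names): `WeilAlgebraicFor`, `WeilAlgebraicAll`, `IsSplitWeilTriple`, `WeilAlgebraicSplit` (Weil classes of
`(A, φ)`, `φ² = -d`, in half-dimension `n`, on all pairs / on split polarized triples), plus the one-line sanity
lemma `weilAlgebraicSplit_of_all`. (The fourth stub's statement `WeilSectorSuffices := TropicalCuspLift.WeilClassesAlgebraic →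
HodgeAbelianVarieties` is a parameter-free edge statement of the line, implied by the crux and open; it stays in the
skeleton and is deliberately NOT declared here, so that nothing in this file can be mistaken for a named fact.) Sources for the notions: van Geemen LNM 1594 §5 (Weil type, discriminant,
split = hyperbolic), Deligne–Milne LNM 900 §4, Markman arXiv:2502.03415 §1 / survey arXiv:2509.23403 §11.5.
-/

-- `Summit.HodgeConjecture.HodgeConjecture.…` is the tree's mandated summit/problem namespace (single-problem summit).
set_option linter.dupNamespace false

noncomputable section

open CategoryTheory
open Literature.AlgebraicGeometry Literature.AlgebraicGeometry.Motives
  Literature.AlgebraicGeometry.HodgeTheory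

namespace Summit.HodgeConjecture.HodgeConjecture.Cruxes.HodgeAbelianVarieties.EStepSecantInduction

/-- **Weil classes of `(A, φ)` in half-dimension `n` for `K = ℚ(√-d)` are algebraic**: every RATIONAL
class of Hodge type `(n,n)` in the complexified Weil plane `weilClassesOf A φ n d = E₊ ⊔ E₋ ⊆ H²ⁿ(A(ℂ);ℂ)`
lies in `algebraicClasses A.X n = Nⁿ H²ⁿ`. Same binder shape as `TropicalCuspLift.WeilClassesAlgebraic`
(`mem_weilClassesOf_iff` is the dictionary). [cite: vanGeemen1994HodgeAV, §5.2] -/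
def WeilAlgebraicFor (n d : ℕ) (A : AbelianVariety ℂ) (φ : A ⟶ A) : Prop :=
  ∀ c ∈ weilClassesOf A φ n d, IsRationalClass c → IsOfHodgeType (2 * n) A.X (2 * n) n n c →
    c ∈ algebraicClasses A.X n

/-- **All Weil-type pairs** of dimension `2n` for `K = ℚ(√-d)`: `φ ≫ φ = -d`. (If the `K`-signature is not
`(n,n)` the only rational `(n,n)`-class of the Weil plane is `0`, so nothing is lost by not saying
"of Weil type".) [cite: vanGeemen1994HodgeAV, §5.2] -/
def WeilAlgebraicAll (n d : ℕ) : Prop :=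
  ∀ (A : AbelianVariety ℂ) (φ : A ⟶ A), A.dim = 2 * n → φ ≫ φ = -(d • 𝟙 A) → WeilAlgebraicFor n d A φ

/-- **A polarized Weil triple `(A, φ, h)` of dimension `2n` for `K = ℚ(√-d)` of SPLIT (= hyperbolic)
type**: `φ ≫ φ = -d`; `h ∈ H²(A(ℂ);ℂ)` a polarization class in the tree's sense (`IsPolarizationClass`:
rational, supported on a divisor, hard Lefschetz in dimension `2n`) that is `φ`-compatible (`φ^* h = d·h`,
van Geemen 5.2); and a `φ^*`-stable rational Lagrangian `2n`-frame of `H¹` for `h^{2n-1} ⌣ x ⌣ y`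
(`IsHyperbolicWeilType`; = Witt index `n` = `det H = (-1)ⁿ mod Nm K^×`, Landherr / van Geemen 5.4 /
Deligne–Milne; Markman survey §11.5 Step 1). Positivity of `h` has no carrier, so the predicate is a priori
wider than "ample" (recorded, immaterial for the line's composition). [cite: vanGeemen1994HodgeAV, Lemma 5.2, 5.4] -/
def IsSplitWeilTriple (n d : ℕ) (A : AbelianVariety ℂ) (φ : A ⟶ A) (h : complexBetti A.X 2) : Prop :=
  A.dim = 2 * n ∧ φ ≫ φ = -(d • 𝟙 A) ∧ IsPolarizationClass (2 * n) A.X h ∧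
    complexBetti.map φ.hom.hom.hom 2 h = (d : ℂ) • h ∧ IsHyperbolicWeilType A φ n h

/-- **Weil classes are algebraic on every SPLIT polarized Weil triple of dimension `2n`** for
`K = ℚ(√-d)` — the sector Markman's secant-sheaf machine outputs (one split component per `(K, n)` up
to isogeny). [cite: Markman2025SurveySecant, §11.5] -/
def WeilAlgebraicSplit (n d : ℕ) : Prop :=
  ∀ (A : AbelianVariety ℂ) (φ : A ⟶ A) (h : complexBetti A.X 2),
    IsSplitWeilTriple n d A φ h → WeilAlgebraicFor n d A φ

/-- Sanity (proved; registered sub-goal `weilAlgebraicSplit_of_all` of stmt-HodgeConjecture-1333): the split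
sector is a sub-case of the full sector. -/
theorem weilAlgebraicSplit_of_all : ∀ {n d : ℕ}, WeilAlgebraicAll n d → WeilAlgebraicSplit n d :=
  fun h A φ _ ht => h A φ ht.1 ht.2.1

end Summit.HodgeConjecture.HodgeConjecture.Cruxes.HodgeAbelianVarieties.EStepSecantInduction

end
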